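import Mathlib
import HarnessLib
import Summits.NavierStokesRegularity.NavierStokesRegularity.Theorems.LocalSineTubeDoorGenericDoor
import Literature.Analysis.FluidPDE.TaoEnstrophyLocalisation
import Literature.Analysis.FluidPDE.SelfSimilar

/-!
# nsreg-p1 ROUND-15 doors S16 / S16′ / S16γ — K1 side: the zoom profile inherits SPACE–TIME Type-I decay, and the
# generic space–time window door (port of the kernel-checked K1 section of nsreg-p1 `r15/Sketch16.lean`)

Frame of the S16 family (as S15): LOCAL SPACE–TIME Type I at `(x₀,T)`, `‖u(t,x)‖ (‖x − x₀‖ + √(ν(T−t))) ≤ M` on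
`B_ρ(x₀) × (T−ρ²,T)`.  Along the tree's universal zoom `localPointZoomVelGradSlices`
(`(λⱼ/ν) u(T + λⱼ² s/ν, x₀ + λⱼ y) → v(s,y)` with gradient slices) the bound passes to the limit:

* `hasTypeIDecay_of_zoom` — `HasTypeIDecay (M/ν) v`;
* `timeTypeI_of_spaceTimeTypeI` — the space–time bound implies the time bound the zoom wants;
* `spaceTimeDoor_of_profileWindowRigidity` — for any continuous first-order scalar `F(A)` of the velocity gradient with
  dilation-invariant zero set, the ONE-WINDOW door in the space–time frame follows from its profile crux stated WITH
  space–time decay of the profile (the tree's window Fatou lemma `windowFatou_firstOrder_of_zeroSetInvariant`);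
* the two scalars of S16/S16′ as lambdas — `ω·Sω = ⟪curlCLM A, A (curlCLM A)⟫` and Betchov's `det (A + A†)`: cubic scaling,
  joint continuity, dilation-invariant zero sets (`stretch_smul`, `strainDet_smul`, `continuous_stretch`,
  `continuous_strainDet`, `stretch_zeroSetInvariant`, `strainDet_zeroSetInvariant`).

All statements and proofs are nsreg-p1 g13's (Sketch16, farm rc 0 there), with the sketch's `def`s unfolded (no definitions
in a Theorems file).  Seat nsreg-p6 g8.  WHAT THIS IS NOT: not NS regularity — K1 plumbing of CONDITIONAL one-window
doors; not a route open.
-/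

noncomputable section

-- the summit and its single sub-problem share the name (CONVENTIONS §1)
set_option linter.dupNamespace false

namespace Summit.NavierStokesRegularity.NavierStokesRegularity.Theorems.PlaneStrainDoorZoomSpaceTimeDecay

open MeasureTheory Set Function Filter Topology Metric
open scoped RealInnerProductSpace InnerProductSpace NNReal ENNReal
open Literature.Analysis Literature.Analysis.FluidPDE
open Summit.NavierStokesRegularity.NavierStokesRegularity.Theorems.LocalSineTubeDoorLocalPointZoomGradSlices
open Summit.NavierStokesRegularity.NavierStokesRegularity.Theorems.LocalSineTubeDoorWindowFatou

/-! ## The two first-order scalars (as lambdas) -/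

/-- Cubic scaling of the production density `σ(A) = ⟪curlCLM A, A (curlCLM A)⟫`. -/
theorem stretch_smul (b : ℝ) (A : EuclideanSpace ℝ (Fin 3) →L[ℝ] EuclideanSpace ℝ (Fin 3)) :
    inner ℝ (curlCLM (b • A)) ((b • A) (curlCLM (b • A))) = b ^ 3 * inner ℝ (curlCLM A) (A (curlCLM A)) := by
  simp only [map_smul, FunLike.coe_smul, Pi.smul_apply, real_inner_smul_left,
    real_inner_smul_right]
  ring

/-- Cubic scaling of Betchov's invariant `det (A + A†)`. -/
theorem strainDet_smul (b : ℝ) (A : EuclideanSpace ℝ (Fin 3) →L[ℝ] EuclideanSpace ℝ (Fin 3)) :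
    (b • A + ContinuousLinearMap.adjoint (b • A)).det = b ^ 3 * (A + ContinuousLinearMap.adjoint A).det := by
  have hadj : ContinuousLinearMap.adjoint (b • A) = b • ContinuousLinearMap.adjoint A := by
    rw [map_smulₛₗ ContinuousLinearMap.adjoint b A]
    simp
  rw [hadj, show b • A + b • ContinuousLinearMap.adjoint A = b • (A + ContinuousLinearMap.adjoint A) by
    rw [smul_add]]
  show LinearMap.det ((b • (A + ContinuousLinearMap.adjoint A) :
      EuclideanSpace ℝ (Fin 3) →L[ℝ] EuclideanSpace ℝ (Fin 3)) : EuclideanSpace ℝ (Fin 3) →ₗ[ℝ] EuclideanSpace ℝ (Fin 3)) =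
    b ^ 3 * LinearMap.det ((A + ContinuousLinearMap.adjoint A :
      EuclideanSpace ℝ (Fin 3) →L[ℝ] EuclideanSpace ℝ (Fin 3)) : EuclideanSpace ℝ (Fin 3) →ₗ[ℝ] EuclideanSpace ℝ (Fin 3))
  rw [ContinuousLinearMap.toLinearMap_smul, LinearMap.det_smul, finrank_euclideanSpace_fin]

/-- Joint continuity of the production density in `(y, A)` (it does not depend on `y`). -/
theorem continuous_stretch : Continuous fun q : EuclideanSpace ℝ (Fin 3) ×
    (EuclideanSpace ℝ (Fin 3) →L[ℝ] EuclideanSpace ℝ (Fin 3)) => inner ℝ (curlCLM q.2) (q.2 (curlCLM q.2)) := by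
  have h1 : Continuous fun A : EuclideanSpace ℝ (Fin 3) →L[ℝ] EuclideanSpace ℝ (Fin 3) => curlCLM A :=
    curlCLM.continuous
  have h2 : Continuous fun A : EuclideanSpace ℝ (Fin 3) →L[ℝ] EuclideanSpace ℝ (Fin 3) => A (curlCLM A) :=
    isBoundedBilinearMap_apply.continuous.comp (continuous_id.prodMk h1)
  exact (h1.inner h2).comp continuous_snd

/-- Joint continuity of Betchov's invariant in `(y, A)`. -/
theorem continuous_strainDet : Continuous fun q : EuclideanSpace ℝ (Fin 3) ×
    (EuclideanSpace ℝ (Fin 3) →L[ℝ] EuclideanSpace ℝ (Fin 3)) => (q.2 + ContinuousLinearMap.adjoint q.2).det := by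
  have h1 : Continuous fun A : EuclideanSpace ℝ (Fin 3) →L[ℝ] EuclideanSpace ℝ (Fin 3) =>
      A + ContinuousLinearMap.adjoint A :=
    continuous_id.add ContinuousLinearMap.adjoint.continuous
  exact (ContinuousLinearMap.continuous_det.comp h1).comp continuous_snd

/-- Dilation invariance of the zero set of the production density. -/
theorem stretch_zeroSetInvariant (a b : ℝ) (_ha : 0 < a) (hb : 0 < b) (x : EuclideanSpace ℝ (Fin 3))
    (A : EuclideanSpace ℝ (Fin 3) →L[ℝ] EuclideanSpace ℝ (Fin 3)) :
    (fun (_ : EuclideanSpace ℝ (Fin 3)) (B : EuclideanSpace ℝ (Fin 3) →L[ℝ] EuclideanSpace ℝ (Fin 3)) =>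
        inner ℝ (curlCLM B) (B (curlCLM B))) (a • x) (b • A) = 0 ↔
      (fun (_ : EuclideanSpace ℝ (Fin 3)) (B : EuclideanSpace ℝ (Fin 3) →L[ℝ] EuclideanSpace ℝ (Fin 3)) =>
        inner ℝ (curlCLM B) (B (curlCLM B))) x A = 0 := by
  simp only [stretch_smul, mul_eq_zero, pow_eq_zero_iff (Nat.succ_ne_zero 2), hb.ne', false_or]

/-- Dilation invariance of the zero set of Betchov's invariant. -/
theorem strainDet_zeroSetInvariant (a b : ℝ) (_ha : 0 < a) (hb : 0 < b) (x : EuclideanSpace ℝ (Fin 3))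
    (A : EuclideanSpace ℝ (Fin 3) →L[ℝ] EuclideanSpace ℝ (Fin 3)) :
    (fun (_ : EuclideanSpace ℝ (Fin 3)) (B : EuclideanSpace ℝ (Fin 3) →L[ℝ] EuclideanSpace ℝ (Fin 3)) =>
        (B + ContinuousLinearMap.adjoint B).det) (a • x) (b • A) = 0 ↔
      (fun (_ : EuclideanSpace ℝ (Fin 3)) (B : EuclideanSpace ℝ (Fin 3) →L[ℝ] EuclideanSpace ℝ (Fin 3)) =>
        (B + ContinuousLinearMap.adjoint B).det) x A = 0 := by
  simp only [strainDet_smul, mul_eq_zero, pow_eq_zero_iff (Nat.succ_ne_zero 2), hb.ne', false_or]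

/-! ## K1: the zoom profile inherits space–time Type-I decay -/

/-- **K1 (nsreg-p1 Sketch16, ported)**: along the tree's zoom `(λⱼ/ν) u(T + λⱼ² s/ν, x₀ + λⱼ y) → v(s,y)`, the local
space–time Type-I bound passes to the limit as `HasTypeIDecay (M/ν) v`. -/
theorem hasTypeIDecay_of_zoom {ν T ρ M : ℝ} (hν : 0 < ν) (hT : 0 < T) (hρ : 0 < ρ)
    {u : ℝ → EuclideanSpace ℝ (Fin 3) → EuclideanSpace ℝ (Fin 3)} {x₀ : EuclideanSpace ℝ (Fin 3)}
    {v : ℝ → EuclideanSpace ℝ (Fin 3) → EuclideanSpace ℝ (Fin 3)} {lam : ℕ → ℝ}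
    (hlam : ∀ j, 0 < lam j) (hlam0 : Tendsto lam atTop (𝓝 0))
    (hM : ∀ t ∈ Set.Ico 0 T, T - ρ ^ 2 < t → ∀ x ∈ Metric.ball x₀ ρ,
      ‖u t x‖ * (‖x - x₀‖ + Real.sqrt (ν * (T - t))) ≤ M)
    (hconv : ∀ s < 0, ∀ y,
      Tendsto (fun j => (lam j / ν) • u (T + lam j ^ 2 * s / ν) (x₀ + lam j • y)) atTop (𝓝 (v s y))) :
    HasTypeIDecay (M / ν) v := by
  intro s hs y
  have hns : 0 < -s := neg_pos.2 hs
  have hden : 0 < ‖y‖ + Real.sqrt (-s) := add_pos_of_nonneg_of_pos (norm_nonneg _) (Real.sqrt_pos.2 hns)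
  -- zoom times and points
  set t : ℕ → ℝ := fun j => T + lam j ^ 2 * s / ν with ht
  have hTt : ∀ j, T - t j = lam j ^ 2 * (-s) / ν := fun j => by simp only [ht]; ring
  have htlt : ∀ j, t j < T := fun j => by
    have : 0 < lam j ^ 2 * (-s) / ν := div_pos (mul_pos (pow_pos (hlam j) 2) hns) hν
    linarith [hTt j]
  have htT : Tendsto t atTop (𝓝 T) := by
    have h1 : Tendsto (fun j => T + lam j ^ 2 * s / ν) atTop (𝓝 (T + 0 ^ 2 * s / ν)) :=
      tendsto_const_nhds.add (((hlam0.pow 2).mul_const s).div_const ν)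
    simpa using h1
  have hxT : Tendsto (fun j => x₀ + lam j • y) atTop (𝓝 x₀) := by
    have h1 : Tendsto (fun j => x₀ + lam j • y) atTop (𝓝 (x₀ + (0 : ℝ) • y)) :=
      tendsto_const_nhds.add (hlam0.smul_const y)
    simpa using h1
  have hev1 : ∀ᶠ j in atTop, 0 < t j := htT.eventually (lt_mem_nhds hT)
  have hev2 : ∀ᶠ j in atTop, T - ρ ^ 2 < t j :=
    htT.eventually (lt_mem_nhds (by nlinarith [pow_pos hρ 2] : T - ρ ^ 2 < T))
  have hev3 : ∀ᶠ j in atTop, x₀ + lam j • y ∈ Metric.ball x₀ ρ :=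
    hxT.eventually (Metric.isOpen_ball.mem_nhds (Metric.mem_ball_self hρ))
  -- the bound along the zoom sequence
  have hbound : ∀ᶠ j in atTop,
      ‖(lam j / ν) • u (T + lam j ^ 2 * s / ν) (x₀ + lam j • y)‖ ≤ M / ν / (‖y‖ + Real.sqrt (-s)) := by
    filter_upwards [hev1, hev2, hev3] with j h1 h2 h3
    have hmem : t j ∈ Set.Ico 0 T := ⟨h1.le, htlt j⟩
    have hMj := hM (t j) hmem h2 (x₀ + lam j • y) h3
    have hdist : ‖x₀ + lam j • y - x₀‖ = lam j * ‖y‖ := by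
      rw [add_sub_cancel_left, norm_smul, Real.norm_eq_abs, abs_of_pos (hlam j)]
    have hsqrt : Real.sqrt (ν * (T - t j)) = lam j * Real.sqrt (-s) := by
      rw [hTt j, show ν * (lam j ^ 2 * (-s) / ν) = lam j ^ 2 * (-s) by field_simp,
        Real.sqrt_mul (pow_nonneg (hlam j).le 2), Real.sqrt_sq (hlam j).le]
    rw [hdist, hsqrt, ← mul_add] at hMj
    have hD : 0 < lam j * (‖y‖ + Real.sqrt (-s)) := mul_pos (hlam j) hden
    have hu : ‖u (t j) (x₀ + lam j • y)‖ ≤ M / (lam j * (‖y‖ + Real.sqrt (-s))) :=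
      (le_div_iff₀ hD).2 hMj
    have hcoef : 0 ≤ lam j / ν := (div_pos (hlam j) hν).le
    have hlj : lam j ≠ 0 := (hlam j).ne'
    calc ‖(lam j / ν) • u (T + lam j ^ 2 * s / ν) (x₀ + lam j • y)‖
        = (lam j / ν) * ‖u (t j) (x₀ + lam j • y)‖ := by
          rw [norm_smul, Real.norm_eq_abs, abs_of_nonneg hcoef]
      _ ≤ (lam j / ν) * (M / (lam j * (‖y‖ + Real.sqrt (-s)))) :=
          mul_le_mul_of_nonneg_left hu hcoef
      _ = M / ν / (‖y‖ + Real.sqrt (-s)) := by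
          field_simp
  exact le_of_tendsto (hconv s hs y).norm hbound

/-- The local space–time Type-I bound implies the time-Type-I bound the tree's zoom lemma wants. -/
theorem timeTypeI_of_spaceTimeTypeI {ν T ρ M : ℝ} {u : ℝ → EuclideanSpace ℝ (Fin 3) → EuclideanSpace ℝ (Fin 3)}
    {x₀ : EuclideanSpace ℝ (Fin 3)}
    (hM : ∀ t ∈ Set.Ico 0 T, T - ρ ^ 2 < t → ∀ x ∈ Metric.ball x₀ ρ,
      ‖u t x‖ * (‖x - x₀‖ + Real.sqrt (ν * (T - t))) ≤ M) :
    ∀ t ∈ Set.Ico 0 T, T - ρ ^ 2 < t → ∀ x ∈ Metric.ball x₀ ρ,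
      ‖u t x‖ * Real.sqrt (ν * (T - t)) ≤ M := by
  intro t ht hρt x hx
  refine le_trans ?_ (hM t ht hρt x hx)
  exact mul_le_mul_of_nonneg_left (le_add_of_nonneg_left (norm_nonneg _)) (norm_nonneg _)

/-- **Generic space–time door (nsreg-p1 Sketch16, ported)**: for any continuous first-order scalar `F(A)` of the velocity
gradient with dilation-invariant zero set, the window door in the SPACE–TIME Type-I frame follows from its profile crux
stated WITH space–time decay of the profile. -/
theorem spaceTimeDoor_of_profileWindowRigidity
    (F : (EuclideanSpace ℝ (Fin 3) →L[ℝ] EuclideanSpace ℝ (Fin 3)) → ℝ)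
    (hF : Continuous fun q : EuclideanSpace ℝ (Fin 3) × (EuclideanSpace ℝ (Fin 3) →L[ℝ] EuclideanSpace ℝ (Fin 3)) => F q.2)
    (hzero : ∀ (a b : ℝ), 0 < a → 0 < b → ∀ (x : EuclideanSpace ℝ (Fin 3))
      (A : EuclideanSpace ℝ (Fin 3) →L[ℝ] EuclideanSpace ℝ (Fin 3)),
      (fun (_ : EuclideanSpace ℝ (Fin 3)) (B : EuclideanSpace ℝ (Fin 3) →L[ℝ] EuclideanSpace ℝ (Fin 3)) => F B)
          (a • x) (b • A) = 0 ↔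
        (fun (_ : EuclideanSpace ℝ (Fin 3)) (B : EuclideanSpace ℝ (Fin 3) →L[ℝ] EuclideanSpace ℝ (Fin 3)) => F B) x A = 0)
    (hcrux : ∀ (C D : ℝ) (v : ℝ → EuclideanSpace ℝ (Fin 3) → EuclideanSpace ℝ (Fin 3)),
      HasTypeITimeDecay C v → HasTypeIDecay D v →
      ContinuousOn (Function.uncurry v) (Set.Iio (0 : ℝ) ×ˢ Set.univ) →
      (∀ s t : ℝ, s < t → t < 0 → ∀ x, v t x =
        UnboundedOperators.heatExtension (v s) (t - s) x - oseenDuhamel 1 s v v t x) →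
      (∀ t < 0, VectorCalculus.IsDivFree (v t)) →
      (∀ s < 0, ∃ U : Set (EuclideanSpace ℝ (Fin 3)), IsOpen U ∧ U.Nonempty ∧ ∀ z ∈ U, F (fderiv ℝ (v s) z) = 0) →
      ¬ IsBackwardSingularPoint v 0) :
    ∀ (ν T : ℝ), 0 < ν → 0 < T → ∀ (u : ℝ → EuclideanSpace ℝ (Fin 3) → EuclideanSpace ℝ (Fin 3))
      (p : ℝ → EuclideanSpace ℝ (Fin 3) → ℝ),
    IsClassicalNSSolutionOn (Set.Ico 0 T) ν 0 u p →
    IsLerayHopfOn T ν 0 (u 0) u →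
    HasRapidSpatialDecay (u 0) →
    ∀ (x₀ : EuclideanSpace ℝ (Fin 3)) (ρ M : ℝ), 0 < ρ →
    (∀ t ∈ Set.Ico 0 T, T - ρ ^ 2 < t → ∀ x ∈ Metric.ball x₀ ρ,
        ‖u t x‖ * (‖x - x₀‖ + Real.sqrt (ν * (T - t))) ≤ M) →
    ∀ (U : Set (EuclideanSpace ℝ (Fin 3))), IsOpen U → U.Nonempty →
    Filter.Tendsto (fun t => ∫⁻ y in U, ENNReal.ofReal
        |F (Real.sqrt (T - t) ^ 2 • fderiv ℝ (u t) (x₀ + Real.sqrt (T - t) • y))|)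
      (nhdsWithin T (Set.Iio T)) (nhds 0) →
    IsBackwardBoundedAt u T x₀ := by
  intro ν T hν hT u p hcl hLH hdec x₀ ρ M hρ hM U hU hUne hfade
  by_contra hnot
  obtain ⟨C, v, lam, hlam, hlam0, ⟨hrate, hcont, hmild, hdiv⟩, hsing, hconv⟩ :=
    localPointZoomVelGradSlices ν T hν hT u p hcl hLH hdec x₀ ρ M hρ (timeTypeI_of_spaceTimeTypeI hM) hnot
  have hdecay : HasTypeIDecay (M / ν) v :=
    hasTypeIDecay_of_zoom hν hT hρ hlam hlam0 hM fun s hs y => (hconv s hs y).1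
  refine hcrux C (M / ν) v hrate hdecay hcont hmild hdiv (fun s hs => ?_) hsing
  have hns : 0 < -s := neg_pos.2 hs
  set σ : ℝ := Real.sqrt (-s) / Real.sqrt ν with hσ
  have hσpos : 0 < σ := div_pos (Real.sqrt_pos.2 hns) (Real.sqrt_pos.2 hν)
  refine ⟨(fun z => σ⁻¹ • z) ⁻¹' U, hU.preimage (continuous_const_smul σ⁻¹), ?_, fun z hz => ?_⟩
  · obtain ⟨u₀, hu₀⟩ := hUne
    refine ⟨σ • u₀, ?_⟩
    show σ⁻¹ • (σ • u₀) ∈ U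
    rwa [smul_smul, inv_mul_cancel₀ hσpos.ne', one_smul]
  · exact windowFatou_firstOrder_of_zeroSetInvariant hν hT hcl hlam hlam0 hrate hcont hmild hconv
      (fun (_ : EuclideanSpace ℝ (Fin 3)) (B : EuclideanSpace ℝ (Fin 3) →L[ℝ] EuclideanSpace ℝ (Fin 3)) => F B)
      hF hzero hU hfade hs hz

end Summit.NavierStokesRegularity.NavierStokesRegularity.Theorems.PlaneStrainDoorZoomSpaceTimeDecay

end
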